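import Summits.RiemannHypothesis.RiemannHypothesis.Theorems.TiltedLandingLaw421R3ColumnImmunity
import Summits.RiemannHypothesis.RiemannHypothesis.Theorems.TiltedLandingLaw421R3RealCrit

/-! # ClusterCount-v2 — W1, THE CLUSTER COUNT DOOR (lens-2 g5; order (O5-a) of `wake/SUMMON-rh33346-lens-2-20260831T015208Z.md` ab7f4ce1)
(v2 = v1 42e0f9410c9007c4 with the §0 helper `untop₀_eq_orderNat` — an alpha-twin of a landed decl of another summit (desk g30 l.7979) — DELETED and
inlined at its single use in `finsum_untop₀_eq_cast`; no statement changes; director l.7980.)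
SUPPORT for crux `TiltedLandingLaw421R` ⟨stmt-RiemannHypothesis-33346⟩, route EarlyAppointments (`--supports … --as helper` only). W1 is the shared DOOR
of the RATE residual (R1u / β2: where the children of a charged cluster sit) and of SUCC's two-pair crossing class (director (CA585)/(CA589)/(CA596);
crit-1 Q6 `q6.py` 8b9503b9: count `= P` on 3 653/3 653 charged cluster bases). It is Kim's window census (tree `Splittings.JensenWindow.census`, Kim 1996
(2.4)) minus Pólya's real Rolle identity (tree `rolleIdentity_of_localB`) plus multiplicity bookkeeping — tree tools only, no new mathematics, 0 sorry.
STATEMENTS ((K) = kernel-checked). §1, for a real entire `G` of order `< 2` (`RealEntireLt2 G`), a Jensen `Window G α β h` and LOCAL B on `(α, β)`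
(Laguerre sign at the real critical points off `Z(G)`; at a frame level: «no NL event on the base»), `K = (α,β) × (−h,h)`:
* `nonreal_count_deriv_eq`: the NON-REAL zeros of `G′` in `K` and those of `G`, both counted with multiplicity, are equally many;
* `offZero_count_deriv_eq_ncard` / `upper_offZero_count_deriv_eq_ncard` ★: the zeros of `G′` OFF `Z(G)` in `K` (resp. in the upper half of `K`), counted
  with multiplicity, number EXACTLY the DISTINCT non-real (resp. upper) zeros of `G` in `K` (a zero of `G` of order `μ` is a zero of `G′` of order `μ − 1`);
  `upper_offZero_nonempty`: hence ≥ 1 zero of `G′` off `Z(G)` in the upper half once `G` has an upper zero in `K`;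
* `child_mem_disc` (LOCALISATION, Jensen + clearance): a non-real zero `w` of `G′` with `α < Re w < β`, the lines `Re = α, β` crossed by no open Jensen
  shadow of `G`, lies in the closed Jensen disc of a non-real zero `a` of `G` with `α < Re a < β`.
§2, legal frame `EngineHyps5 2`, band state `v ∈ StTrkDQ … j`, clear abscissae `α < Re v < β` with clean feet (the binders of tree `window_of_clear`):
`clusterCount` ★★★ = the upper count for `G = f⁽ʲ⁾` with «`w ∈ K`» replaced by «`Re w ∈ (α, β)`» (strip heredity `abs_im_le_of_level`, `window_sets_eq`);
`clusterCount_of_charged` = the same at a CHARGED level (`Charged P St ReadyR2 … j` + base in the LAW's range `|c − x₀| < (j+3)R/2` ⇒ local B,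
`localB_of_charged`).
READING FOR A CLUSTER (words, not typed — the tree has no cluster object): for a cluster `S` (connected component of the union `Ū` of the closed Jensen discs
of the upper zeros of `f⁽ʲ⁾`) with outer feet `α < β`: (i) the feet are clear — a disc whose OPEN shadow crossed a foot line would contain that foot, which
lies in `Ū`, so its zero would belong to `S` and the foot would not be extreme; (ii) the upper zeros with abscissa in `(α, β)` are exactly the members of `S`
(`Ū ∩ ℝ = [α, β]` by connectedness). So `clusterCount_of_charged` + `child_mem_disc` read «charged cluster base with clean feet ⇒ exactly `P = |S|` upper
children of `f⁽ʲ⁺¹⁾` off `Z(f⁽ʲ⁾)` above `(α, β)`, counted with multiplicity, each inside `Ū`» (F1 of crit-1 Q4/Q6). Dirty feet (a real zero of `f⁽ʲ⁾` or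
`f⁽ʲ⁺¹⁾` AT a foot) are not treated: shift the abscissa by `ε` first (as in `…R3Lens1PinningIsoB`).
NOT CLAIMED: any PER-LENS / PER-COMPONENT occupancy bound (crit-1 Q6: per-lens FALSE, per-component an untyped census object); where inside `Ū` the children
sit beyond `child_mem_disc`; anything about R1u / ★A. Nothing here bears on the truth of RH; RH is NOT proved; R1u / ★A / 33346 / 33347 OPEN;
checked ≠ landed ≠ proved. -/

namespace RhW08.ClusterCount

open Complex ComplexConjugate Set Metric
open Literature.Analysis.Complex
open Summit.RiemannHypothesis.RiemannHypothesis.Theorems.Splittings.JensenWindow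

/-! ## §0 Order bookkeeping helpers -/

/-- (K) §0 over a finite set the census multiplicities of an entire `g` sum, in `ℂ`, to the cast of the `ℕ`-valued orders. -/
theorem finsum_untop₀_eq_cast {g : ℂ → ℂ} (hg : Differentiable ℂ g) {S : Set ℂ} (hS : S.Finite) :
    ∑ᶠ ρ ∈ S, ((meromorphicOrderAt g ρ).untop₀ : ℂ) = ((∑ ρ ∈ hS.toFinset, analyticOrderNatAt g ρ : ℕ) : ℂ) := by
  rw [finsum_mem_eq_finite_toFinset_sum _ hS, Nat.cast_sum]
  refine Finset.sum_congr rfl fun ρ _ => ?_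
  have h1 : (meromorphicOrderAt g ρ).untop₀ = (analyticOrderNatAt g ρ : ℤ) := by
    rw [(hg.analyticAt ρ).meromorphicOrderAt_eq]
    cases h : analyticOrderAt g ρ <;> simp [analyticOrderNatAt, h]
  rw [h1, Int.cast_natCast]

/-- (K) §0 the census count splits into its real-axis part and the sum over the NON-REAL zeros. -/
theorem zeroCountC_eq_real_add_nonreal (g : ℂ → ℂ) (K : Set ℂ) (hfin : {ρ : ℂ | g ρ = 0 ∧ ρ ∈ K}.Finite) :
    zeroCountC g K = zeroCountC g (K ∩ {ρ | ρ.im = 0}) +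
      ∑ᶠ ρ ∈ {ρ : ℂ | (g ρ = 0 ∧ ρ ∈ K) ∧ ρ.im ≠ 0}, ((meromorphicOrderAt g ρ).untop₀ : ℂ) := by
  have e2 : {ρ : ℂ | g ρ = 0 ∧ ρ ∈ K} = {ρ : ℂ | g ρ = 0 ∧ ρ ∈ K ∩ {ρ | ρ.im = 0}} ∪ {ρ : ℂ | (g ρ = 0 ∧ ρ ∈ K) ∧ ρ.im ≠ 0} := by
    ext ρ; simp only [mem_setOf_eq, mem_inter_iff, mem_union]; tauto
  have hdisj : Disjoint {ρ : ℂ | g ρ = 0 ∧ ρ ∈ K ∩ {ρ | ρ.im = 0}} {ρ : ℂ | (g ρ = 0 ∧ ρ ∈ K) ∧ ρ.im ≠ 0} :=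
    Set.disjoint_left.mpr fun ρ h1 h2 => h2.2 h1.2.2
  unfold zeroCountC
  rw [e2, finsum_mem_union hdisj (hfin.subset fun ρ hρ => ⟨hρ.1, hρ.2.1⟩) (hfin.subset fun ρ hρ => hρ.1)]

/-- (K) §0 the non-real points of a conjugation-invariant predicate = the upper ones ∪ the conjugates of the upper ones … -/
theorem nonreal_eq_upper_union_conj (p : ℂ → Prop) (hp : ∀ ρ, p (conj ρ) ↔ p ρ) :
    {ρ : ℂ | p ρ ∧ ρ.im ≠ 0} = {ρ : ℂ | p ρ ∧ 0 < ρ.im} ∪ conj '' {ρ : ℂ | p ρ ∧ 0 < ρ.im} := by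
  ext ρ
  simp only [mem_setOf_eq, mem_union, mem_image]
  refine ⟨fun ⟨hρ, him⟩ => (lt_or_gt_of_ne him).elim (fun hlt => Or.inr ⟨conj ρ, ⟨(hp ρ).2 hρ, by simpa using hlt⟩, conj_conj ρ⟩)
    fun hgt => Or.inl ⟨hρ, hgt⟩, ?_⟩
  rintro (⟨hρ, hgt⟩ | ⟨σ, ⟨hσ, hσpos⟩, rfl⟩)
  · exact ⟨hρ, hgt.ne'⟩
  · exact ⟨(hp σ).2 hσ, by rw [conj_im]; linarith⟩

/-- (K) §0 … and the two parts are disjoint. -/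
theorem disjoint_upper_conj (p : ℂ → Prop) : Disjoint {ρ : ℂ | p ρ ∧ 0 < ρ.im} (conj '' {ρ : ℂ | p ρ ∧ 0 < ρ.im}) :=
  Set.disjoint_left.mpr fun ρ hρ ⟨σ, hσ, e⟩ => by rw [← e] at hρ; have := hρ.2; rw [conj_im] at this; linarith [hσ.2]

/-- (K) §0 CONJUGATION HALVES A SYMMETRIC COUNT: for conjugation-invariant `p` and weight `φ`, the `φ`-count of the non-real points of `p` is twice the
count of the upper ones; likewise for the NUMBER of points. -/
theorem finsum_nonreal_eq_two_mul_upper (p : ℂ → Prop) (φ : ℂ → ℕ) (hp : ∀ ρ, p (conj ρ) ↔ p ρ) (hφ : ∀ ρ, φ (conj ρ) = φ ρ)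
    (hfin : {ρ : ℂ | p ρ ∧ ρ.im ≠ 0}.Finite) :
    ∑ᶠ ρ ∈ {ρ : ℂ | p ρ ∧ ρ.im ≠ 0}, φ ρ = 2 * ∑ᶠ ρ ∈ {ρ : ℂ | p ρ ∧ 0 < ρ.im}, φ ρ := by
  have hfin' : {ρ : ℂ | p ρ ∧ 0 < ρ.im}.Finite := hfin.subset fun ρ hρ => ⟨hρ.1, hρ.2.ne'⟩
  rw [nonreal_eq_upper_union_conj p hp, finsum_mem_union (disjoint_upper_conj p) hfin' (hfin'.image _),
    finsum_mem_image (starRingEnd ℂ).injective.injOn]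
  simp_rw [hφ]
  ring

/-- (K) §0 see `finsum_nonreal_eq_two_mul_upper`. -/
theorem ncard_nonreal_eq_two_mul_upper (p : ℂ → Prop) (hp : ∀ ρ, p (conj ρ) ↔ p ρ) (hfin : {ρ : ℂ | p ρ ∧ ρ.im ≠ 0}.Finite) :
    {ρ : ℂ | p ρ ∧ ρ.im ≠ 0}.ncard = 2 * {ρ : ℂ | p ρ ∧ 0 < ρ.im}.ncard := by
  have hfin' : {ρ : ℂ | p ρ ∧ 0 < ρ.im}.Finite := hfin.subset fun ρ hρ => ⟨hρ.1, hρ.2.ne'⟩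
  rw [nonreal_eq_upper_union_conj p hp, Set.ncard_union_eq (disjoint_upper_conj p) hfin' (hfin'.image _),
    Set.ncard_image_of_injective _ (starRingEnd ℂ).injective]
  ring

/-! ## §1 THE WINDOW COUNT for a real entire `G` of order `< 2` (Kim 1996 window census − Pólya's real Rolle identity) -/

variable {G : ℂ → ℂ}

/-- (K) §1 the zeros of `G` and of `G′` in the open window are finite sets (`f, f′ ≠ 0` at the corner `α`). -/
theorem finite_window (hG : RealEntireLt2 G) {α β h : ℝ} (hW : Window G α β h) :
    {ρ : ℂ | G ρ = 0 ∧ ρ ∈ (Ioo α β ×ℂ Ioo (-h) h)}.Finite ∧ {ρ : ℂ | deriv G ρ = 0 ∧ ρ ∈ (Ioo α β ×ℂ Ioo (-h) h)}.Finite := by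
  have hαmem : ((α : ℝ) : ℂ) ∈ Icc α β ×ℂ Icc (-h) h := ⟨by simpa using hW.lt.le, by simp [hW.pos.le]⟩
  exact ⟨finite_zeros_reProdIm hW.lt.le (by linarith [hW.pos]) (fun z _ => hG.diff.analyticAt z) hαmem hW.fα,
    finite_zeros_reProdIm hW.lt.le (by linarith [hW.pos]) (fun z _ => hG.diff.deriv.analyticAt z) hαmem hW.dα⟩

/-- ★★ (K) §1 **NON-REAL MULTIPLICITIES AGREE**: in a Jensen `Window` of `G` with local B on the base, the non-real zeros of `G′` in the open window,
counted with multiplicity, are as many as those of `G` — census `2(N′ − N) = σ_α − σ_β` minus Rolle identity `2(N′_ℝ − N_ℝ) = σ_α − σ_β`. -/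
theorem nonreal_count_deriv_eq (hG : RealEntireLt2 G) {α β h : ℝ} (hW : Window G α β h) (hB : LocalB G α β) (hex : ∃ a, G a = 0) :
    ∑ᶠ ρ ∈ {ρ : ℂ | (deriv G ρ = 0 ∧ ρ ∈ (Ioo α β ×ℂ Ioo (-h) h)) ∧ ρ.im ≠ 0}, ((meromorphicOrderAt (deriv G) ρ).untop₀ : ℂ) =
      ∑ᶠ ρ ∈ {ρ : ℂ | (G ρ = 0 ∧ ρ ∈ (Ioo α β ×ℂ Ioo (-h) h)) ∧ ρ.im ≠ 0}, ((meromorphicOrderAt G ρ).untop₀ : ℂ) := by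
  have hc := census hG hW hex
  have hR := rolleIdentity_of_localB hG hW hB
  unfold RolleIdentity at hR
  obtain ⟨hfin, hfin'⟩ := finite_window hG hW
  rw [zeroCountC_eq_real_add_nonreal G _ hfin, zeroCountC_eq_real_add_nonreal (deriv G) _ hfin'] at hc
  linear_combination (1 / 2 : ℂ) * hc - (1 / 2 : ℂ) * hR

/-- ★★★ (K) §1 **ZEROS OF `G′` OFF `Z(G)`, COUNTED WITH MULTIPLICITY = NUMBER OF DISTINCT NON-REAL ZEROS OF `G`** (open window, both half-planes):
at a common zero `ord G′ = ord G − 1` (`AnalyticAt.analyticOrderAt_deriv_add_one`), so `nonreal_count_deriv_eq` sheds one unit per DISTINCT zero. -/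
theorem offZero_count_deriv_eq_ncard (hG : RealEntireLt2 G) {α β h : ℝ} (hW : Window G α β h) (hB : LocalB G α β) (hex : ∃ a, G a = 0) :
    ∑ᶠ ρ ∈ {ρ : ℂ | (deriv G ρ = 0 ∧ G ρ ≠ 0 ∧ ρ ∈ (Ioo α β ×ℂ Ioo (-h) h)) ∧ ρ.im ≠ 0}, analyticOrderNatAt (deriv G) ρ =
      {ρ : ℂ | (G ρ = 0 ∧ ρ ∈ (Ioo α β ×ℂ Ioo (-h) h)) ∧ ρ.im ≠ 0}.ncard := by
  classical
  set K : Set ℂ := Ioo α β ×ℂ Ioo (-h) h with hKdef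
  have hd : Differentiable ℂ (deriv G) := hG.diff.deriv
  have hGne : G ≠ 0 := fun h0 => hW.fα (by rw [h0]; rfl)
  obtain ⟨hfin, hfin'⟩ := finite_window hG hW
  have hZ : {ρ : ℂ | (G ρ = 0 ∧ ρ ∈ K) ∧ ρ.im ≠ 0}.Finite := hfin.subset fun ρ hρ => hρ.1
  have hC : {ρ : ℂ | (deriv G ρ = 0 ∧ ρ ∈ K) ∧ ρ.im ≠ 0}.Finite := hfin'.subset fun ρ hρ => hρ.1
  have hO : {ρ : ℂ | (deriv G ρ = 0 ∧ G ρ ≠ 0 ∧ ρ ∈ K) ∧ ρ.im ≠ 0}.Finite := hfin'.subset fun ρ hρ => ⟨hρ.1.1, hρ.1.2.2⟩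
  have h1 := nonreal_count_deriv_eq hG hW hB hex
  rw [← hKdef, finsum_untop₀_eq_cast hd hC, finsum_untop₀_eq_cast hG.diff hZ] at h1
  have h1' : ∑ ρ ∈ hC.toFinset, analyticOrderNatAt (deriv G) ρ = ∑ ρ ∈ hZ.toFinset, analyticOrderNatAt G ρ := by exact_mod_cast h1
  have sumZ : ∑ ρ ∈ hZ.toFinset, analyticOrderNatAt G ρ = ∑ ρ ∈ hZ.toFinset, analyticOrderNatAt (deriv G) ρ + hZ.toFinset.card := by
    rw [Finset.card_eq_sum_ones, ← Finset.sum_add_distrib]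
    refine Finset.sum_congr rfl fun ρ hρ => ?_
    rw [Set.Finite.mem_toFinset] at hρ
    exact (RhW08.RealCrit.analyticOrderNatAt_deriv_add_one_of_entire hG.diff hGne hρ.1.1).symm
  have splitC := Finset.sum_filter_add_sum_filter_not hC.toFinset (fun ρ => G ρ ≠ 0) (fun ρ => analyticOrderNatAt (deriv G) ρ)
  have eO : hC.toFinset.filter (fun ρ => G ρ ≠ 0) = hO.toFinset := by
    ext ρ
    simp only [Finset.mem_filter, Set.Finite.mem_toFinset, mem_setOf_eq]
    tauto
  have eC : ∑ ρ ∈ hC.toFinset.filter (fun ρ => ¬ G ρ ≠ 0), analyticOrderNatAt (deriv G) ρ =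
      ∑ ρ ∈ hZ.toFinset, analyticOrderNatAt (deriv G) ρ := by
    apply Finset.sum_subset
    · intro ρ hρ
      simp only [Finset.mem_filter, Set.Finite.mem_toFinset, mem_setOf_eq, not_not] at hρ ⊢
      exact ⟨⟨hρ.2, hρ.1.1.2⟩, hρ.1.2⟩
    · intro ρ hρZ hρC
      rw [Set.Finite.mem_toFinset] at hρZ
      by_contra hne
      apply hρC
      rw [Finset.mem_filter, Set.Finite.mem_toFinset]
      exact ⟨⟨⟨apply_eq_zero_of_analyticOrderNatAt_ne_zero hne, hρZ.1.2⟩, hρZ.2⟩, not_not.mpr hρZ.1.1⟩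
  rw [eO, eC] at splitC
  rw [finsum_mem_eq_finite_toFinset_sum _ hO, Set.ncard_eq_toFinset_card _ hZ]
  omega

/-- ★★★ (K) §1 **THE UPPER-HALF COUNT**: the zeros of `G′` off `Z(G)` in the UPPER half of the open window, counted with multiplicity, are exactly as
many as the DISTINCT upper zeros of `G` there (conjugation symmetry of zeros and of orders, `DeBruijn1950.analyticOrderNatAt_conj`). -/
theorem upper_offZero_count_deriv_eq_ncard (hG : RealEntireLt2 G) {α β h : ℝ} (hW : Window G α β h) (hB : LocalB G α β)
    (hex : ∃ a, G a = 0) :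
    ∑ᶠ ρ ∈ {ρ : ℂ | (deriv G ρ = 0 ∧ G ρ ≠ 0 ∧ ρ ∈ (Ioo α β ×ℂ Ioo (-h) h)) ∧ 0 < ρ.im}, analyticOrderNatAt (deriv G) ρ =
      {ρ : ℂ | (G ρ = 0 ∧ ρ ∈ (Ioo α β ×ℂ Ioo (-h) h)) ∧ 0 < ρ.im}.ncard := by
  have h2 := offZero_count_deriv_eq_ncard hG hW hB hex
  obtain ⟨hfin, hfin'⟩ := finite_window hG hW
  have hd : Differentiable ℂ (deriv G) := hG.diff.deriv
  have hdreal : ∀ x : ℝ, (deriv G x).im = 0 := im_deriv_ofReal hG.diff hG.real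
  have hK : ∀ ρ : ℂ, conj ρ ∈ (Ioo α β ×ℂ Ioo (-h) h) ↔ ρ ∈ (Ioo α β ×ℂ Ioo (-h) h) := by
    intro ρ
    simp only [mem_reProdIm, conj_re, conj_im, mem_Ioo]
    constructor <;> rintro ⟨h1, h2, h3⟩ <;> exact ⟨h1, by linarith, by linarith⟩
  have hGc : ∀ ρ : ℂ, G (conj ρ) = 0 ↔ G ρ = 0 := fun ρ => by rw [apply_conj_eq_conj hG.diff hG.real, map_eq_zero]
  have hdc : ∀ ρ : ℂ, deriv G (conj ρ) = 0 ↔ deriv G ρ = 0 := fun ρ => by rw [apply_conj_eq_conj hd hdreal, map_eq_zero]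
  have hsO := finsum_nonreal_eq_two_mul_upper (fun ρ => deriv G ρ = 0 ∧ G ρ ≠ 0 ∧ ρ ∈ (Ioo α β ×ℂ Ioo (-h) h))
    (analyticOrderNatAt (deriv G)) (fun ρ => by rw [hdc, hK, ne_eq, ne_eq, hGc])
    (DeBruijn1950.analyticOrderNatAt_conj hd (apply_conj_eq_conj hd hdreal)) (hfin'.subset fun ρ hρ => ⟨hρ.1.1, hρ.1.2.2⟩)
  have hsZ := ncard_nonreal_eq_two_mul_upper (fun ρ => G ρ = 0 ∧ ρ ∈ (Ioo α β ×ℂ Ioo (-h) h)) (fun ρ => by rw [hGc, hK])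
    (hfin.subset fun ρ hρ => hρ.1)
  omega

/-- (K) §1 hence at least one upper zero of `G′` OFF `Z(G)` in the window as soon as `G` has an upper zero there (each summand above is `≥ 1` by
`RhW08.RealCrit.analyticOrderNatAt_ne_zero_of_entire`, so also: the DISTINCT such zeros of `G′` are at most the distinct upper zeros of `G`). -/
theorem upper_offZero_nonempty (hG : RealEntireLt2 G) {α β h : ℝ} (hW : Window G α β h) (hB : LocalB G α β)
    {u : ℂ} (hu : G u = 0) (huK : u ∈ (Ioo α β ×ℂ Ioo (-h) h)) (hupos : 0 < u.im) :
    ∃ w : ℂ, deriv G w = 0 ∧ G w ≠ 0 ∧ w ∈ (Ioo α β ×ℂ Ioo (-h) h) ∧ 0 < w.im := by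
  have key := upper_offZero_count_deriv_eq_ncard hG hW hB ⟨u, hu⟩
  have hZ : {ρ : ℂ | (G ρ = 0 ∧ ρ ∈ (Ioo α β ×ℂ Ioo (-h) h)) ∧ 0 < ρ.im}.Finite := (finite_window hG hW).1.subset fun ρ hρ => hρ.1
  have hpos := (Set.ncard_pos hZ).mpr ⟨u, ⟨hu, huK⟩, hupos⟩
  by_contra hno
  have hempty : {ρ : ℂ | (deriv G ρ = 0 ∧ G ρ ≠ 0 ∧ ρ ∈ (Ioo α β ×ℂ Ioo (-h) h)) ∧ 0 < ρ.im} = ∅ :=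
    Set.eq_empty_iff_forall_notMem.mpr fun ρ hρ => hno ⟨ρ, hρ.1.1, hρ.1.2.1, hρ.1.2.2, hρ.2⟩
  rw [hempty, finsum_mem_empty] at key
  omega

/-- ★★ (K) §1 **LOCALISATION** (Jensen's theorem + clear abscissae): a non-real zero `w` of `G′` with `α < Re w < β`, the lines `Re = α`, `Re = β`
crossed by no open Jensen shadow of `G`, lies in the CLOSED Jensen disc of a non-real zero `a` of `G` with `α < Re a < β` (frame use:
`G = f⁽ʲ⁾`, `hG = RhW08.WindowLoss.realEntireLt2_iteratedDeriv (realEntireLt2_of_hyps hE) j`, `deriv G = f⁽ʲ⁺¹⁾` by `iteratedDeriv_succ`). -/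
theorem child_mem_disc (hG : RealEntireLt2 G) {α β : ℝ}
    (hclα : ∀ a : ℂ, G a = 0 → a.im ≠ 0 → |a.im| ≤ |α - a.re|) (hclβ : ∀ a : ℂ, G a = 0 → a.im ≠ 0 → |a.im| ≤ |β - a.re|)
    (hd : ∃ z, deriv G z ≠ 0) {w : ℂ} (hw : deriv G w = 0) (hwim : w.im ≠ 0) (hwre : w.re ∈ Ioo α β) :
    ∃ a : ℂ, G a = 0 ∧ a.im ≠ 0 ∧ a.re ∈ Ioo α β ∧ ‖w - a.re‖ ≤ |a.im| := by
  obtain ⟨ρ, C, hρ0, hρ, hgr⟩ := hG.growth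
  obtain ⟨a, ha, hwa⟩ := jensen_circle hG.diff hρ0 hρ hgr hG.real hd hwim hw
  have him : |w.im| ≤ |a.im| := le_trans (by simpa using abs_im_le_norm (w - a.re)) hwa
  have hre : |w.re - a.re| ≤ |a.im| := le_trans (by simpa using abs_re_le_norm (w - a.re)) hwa
  have haim : a.im ≠ 0 := fun h0 => hwim (abs_eq_zero.mp (le_antisymm (by simpa [h0] using him) (abs_nonneg _)))
  refine ⟨a, ha, haim, ⟨?_, ?_⟩, hwa⟩
  · by_contra hle
    have h1 := hclα a ha haim
    rw [abs_of_nonneg (by linarith : 0 ≤ α - a.re)] at h1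
    linarith [hwre.1, le_abs_self (w.re - a.re)]
  · by_contra hle
    have h1 := hclβ a ha haim
    rw [abs_of_nonpos (by linarith : β - a.re ≤ 0)] at h1
    linarith [hwre.2, neg_le_abs (w.re - a.re)]

/-! ## §2 THE FRAME DOOR: a clear window of `f⁽ʲ⁾` at a level without NL events on the base (e.g. a CHARGED level) -/

open RhIdea6.G17.W07C7 RhIdea6.G17.W07C7.Rev6 RhIdea6.G18.W07C8.Law421BirthS RhIdea6.G19.W07C11.Seam
open RhIdea6.G20.W07C12.Frac RhIdea6.G20.W07C12.StColP RhW07.C12.FieldSplit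
open RhW08.Round1 RhW08.StSwap RhW08.Round2 RhW08.QuadW

/-- (K) §2 `Charged` (a lowest tracked state is not Ready′) forbids every NL event of level `j` in the LAW's range `|c − x₀| < (j+3)R/2`; hence local B
holds on any base `(α, β)` inside that range (contrapositive of tree `nlEventOf_of_not_localB`). -/
theorem localB_of_charged {P St : StatePred} {η : ℝ} {f : ℂ → ℂ} {x₀ s hmax R Hs : ℝ} {B j : ℕ} (hf : RealEntireLt2 f)
    (hC : Charged P St ReadyR2 η f x₀ s hmax R Hs B j) {α β : ℝ} (hrange : ∀ c ∈ Ioo α β, |c - x₀| < ((j : ℝ) + 3) * R / 2) :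
    LocalB (iteratedDeriv j f) α β := by
  by_contra hB
  obtain ⟨c, hc, hNL⟩ := nlEventOf_of_not_localB hf j hB
  obtain ⟨v', -, hnr, -⟩ := hC
  unfold ReadyR2 CumReady WinOrTilt TiltReady at hnr
  exact hnr ⟨j, le_rfl, Or.inr ⟨c, hrange c hc, hNL⟩⟩

/-- (K) §2 in a legal frame the zeros of `f⁽ʲ⁾ ≢ 0` and of `f⁽ʲ⁺¹⁾ ≢ 0` lie in the strip `|Im| ≤ Hs` (analytic heredity), so «in the open window of
height `Hs + 1`» is the same as «abscissa in `(α, β)`» for both populations. -/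
theorem window_sets_eq {η : ℝ} {f : ℂ → ℂ} {x₀ s hmax R Hs : ℝ} {B j : ℕ} (hE : EngineHyps5 2 η f x₀ s hmax R Hs B)
    (hGne : iteratedDeriv j f ≠ 0) (hdne : iteratedDeriv (j + 1) f ≠ 0) (α β : ℝ) :
    {w : ℂ | (iteratedDeriv (j + 1) f w = 0 ∧ iteratedDeriv j f w ≠ 0 ∧ w ∈ (Ioo α β ×ℂ Ioo (-(Hs + 1)) (Hs + 1))) ∧ 0 < w.im} =
        {w : ℂ | (iteratedDeriv (j + 1) f w = 0 ∧ iteratedDeriv j f w ≠ 0 ∧ w.re ∈ Ioo α β) ∧ 0 < w.im} ∧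
      {a : ℂ | (iteratedDeriv j f a = 0 ∧ a ∈ (Ioo α β ×ℂ Ioo (-(Hs + 1)) (Hs + 1))) ∧ 0 < a.im} =
        {a : ℂ | (iteratedDeriv j f a = 0 ∧ a.re ∈ Ioo α β) ∧ 0 < a.im} := by
  constructor
  · ext w
    simp only [mem_setOf_eq, mem_reProdIm, mem_Ioo]
    refine ⟨fun ⟨⟨h1, h2, h3, _⟩, h4⟩ => ⟨⟨h1, h2, h3⟩, h4⟩, fun ⟨⟨h1, h2, h3⟩, h4⟩ => ⟨⟨h1, h2, h3, ?_⟩, h4⟩⟩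
    have h5 := abs_le.mp (RhW08.Column.abs_im_le_of_level hE hdne h1)
    constructor <;> linarith
  · ext a
    simp only [mem_setOf_eq, mem_reProdIm, mem_Ioo]
    refine ⟨fun ⟨⟨h1, h2, _⟩, h4⟩ => ⟨⟨h1, h2⟩, h4⟩, fun ⟨⟨h1, h2⟩, h4⟩ => ⟨⟨h1, h2, ?_⟩, h4⟩⟩
    have h5 := abs_le.mp (RhW08.Column.abs_im_le_of_level hE hGne h1)
    constructor <;> linarith

/-- ★★★ (K) §2 **W1 — THE CLUSTER COUNT, window form.**  Legal frame, band state `v` of level `j`, abscissae `α < Re v < β` crossed by no open Jensen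
shadow of `f⁽ʲ⁾`, clean feet (`f⁽ʲ⁾, f⁽ʲ⁺¹⁾ ≠ 0` at `α, β`), local B on `(α, β)` (at a CHARGED level: `localB_of_charged`).  THEN the UPPER zeros of
`f⁽ʲ⁺¹⁾` OFF `Z(f⁽ʲ⁾)` with abscissa in `(α, β)`, counted with multiplicity, number EXACTLY the distinct upper zeros of `f⁽ʲ⁾` with abscissa in `(α, β)`.
For a cluster window (`α, β` = outer feet) the latter are its `P` members and the former lie in `Ū` (`child_mem_disc_of_clear`): «exactly `P` children». -/
theorem clusterCount {η : ℝ} {f : ℂ → ℂ} {x₀ s hmax R Hs : ℝ} {B j : ℕ} {v : ℂ}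
    (hE : EngineHyps5 2 η f x₀ s hmax R Hs B) (hv : StTrkDQ η f x₀ s hmax R Hs B j v) {α β : ℝ} (hαv : α < v.re) (hvβ : v.re < β)
    (hclα : ∀ a : ℂ, iteratedDeriv j f a = 0 → a.im ≠ 0 → |a.im| ≤ |α - a.re|)
    (hclβ : ∀ a : ℂ, iteratedDeriv j f a = 0 → a.im ≠ 0 → |a.im| ≤ |β - a.re|)
    (hGα : iteratedDeriv j f α ≠ 0) (hGβ : iteratedDeriv j f β ≠ 0)
    (hdα : iteratedDeriv (j + 1) f α ≠ 0) (hdβ : iteratedDeriv (j + 1) f β ≠ 0) (hB : LocalB (iteratedDeriv j f) α β) :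
    ∑ᶠ w ∈ {w : ℂ | (iteratedDeriv (j + 1) f w = 0 ∧ iteratedDeriv j f w ≠ 0 ∧ w.re ∈ Ioo α β) ∧ 0 < w.im},
        analyticOrderNatAt (iteratedDeriv (j + 1) f) w =
      {a : ℂ | (iteratedDeriv j f a = 0 ∧ a.re ∈ Ioo α β) ∧ 0 < a.im}.ncard := by
  obtain ⟨hW, -⟩ := RhW08.Column.window_of_clear hE hv hαv hvβ hclα hclβ hGα hGβ hdα hdβ
  have hG : RealEntireLt2 (iteratedDeriv j f) := RhW08.WindowLoss.realEntireLt2_iteratedDeriv (RhW08.Column.realEntireLt2_of_hyps hE) j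
  have e1 : deriv (iteratedDeriv j f) = iteratedDeriv (j + 1) f := by rw [← iteratedDeriv_succ]
  have key := upper_offZero_count_deriv_eq_ncard hG hW hB ⟨v, hv.2.1⟩
  obtain ⟨eS, eZ⟩ := window_sets_eq hE hv.1 (iteratedDeriv_succ_ne_zero_of_zero hE.1 j hv.1 hv.2.1) α β
  rwa [e1, eS, eZ] at key

/-- ★★★ (K) §2 **W1 AT A CHARGED LEVEL** («charged cluster base ⇒ exactly `P` upper children of `f⁽ʲ⁺¹⁾` off `Z(f⁽ʲ⁾)`»): the same count, local B
being supplied by `Charged P St ReadyR2 … j` and the base lying in the LAW's range. -/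
theorem clusterCount_of_charged {P St : StatePred} {η : ℝ} {f : ℂ → ℂ} {x₀ s hmax R Hs : ℝ} {B j : ℕ} {v : ℂ}
    (hE : EngineHyps5 2 η f x₀ s hmax R Hs B) (hC : Charged P St ReadyR2 η f x₀ s hmax R Hs B j)
    (hv : StTrkDQ η f x₀ s hmax R Hs B j v) {α β : ℝ} (hαv : α < v.re) (hvβ : v.re < β)
    (hrange : ∀ c ∈ Ioo α β, |c - x₀| < ((j : ℝ) + 3) * R / 2)
    (hclα : ∀ a : ℂ, iteratedDeriv j f a = 0 → a.im ≠ 0 → |a.im| ≤ |α - a.re|)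
    (hclβ : ∀ a : ℂ, iteratedDeriv j f a = 0 → a.im ≠ 0 → |a.im| ≤ |β - a.re|)
    (hGα : iteratedDeriv j f α ≠ 0) (hGβ : iteratedDeriv j f β ≠ 0)
    (hdα : iteratedDeriv (j + 1) f α ≠ 0) (hdβ : iteratedDeriv (j + 1) f β ≠ 0) :
    ∑ᶠ w ∈ {w : ℂ | (iteratedDeriv (j + 1) f w = 0 ∧ iteratedDeriv j f w ≠ 0 ∧ w.re ∈ Ioo α β) ∧ 0 < w.im},
        analyticOrderNatAt (iteratedDeriv (j + 1) f) w =
      {a : ℂ | (iteratedDeriv j f a = 0 ∧ a.re ∈ Ioo α β) ∧ 0 < a.im}.ncard :=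
  clusterCount hE hv hαv hvβ hclα hclβ hGα hGβ hdα hdβ (localB_of_charged (RhW08.Column.realEntireLt2_of_hyps hE) hC hrange)

end RhW08.ClusterCount
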